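import Mathlib.RingTheory.Nullstellensatz
import Mathlib.FieldTheory.IsAlgClosed.Basic
import Mathlib.RingTheory.Algebraic.Defs
import Mathlib.Data.ZMod.Basic
import HarnessLib

/-!
# Intersection of a correspondence with the graph of Frobenius is non-empty
# (Hrushovski 2004, Cor. 1.2; Varshavsky 2014/2018, Thm. 1 and Cor. 2) — affine form

Topic: `Literature/NumberTheory/DiophantineGeometry` (next to the Lang–Weil facts of
`CafureMatera.lean`: with `C` the diagonal the statement below is the qualitative Lang–Weil theorem).
Sources read: Y. Varshavsky, *Intersection of a correspondence with a graph of Frobenius*,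
J. Algebraic Geom. 27 (2018) 1–20 = arXiv:1405.6381, Introduction p. 1, Theorem 0.1 = "Theorem 1"
and Corollaries 2–4 of the arXiv text [Varshavsky2014]; E. Hrushovski, *The elementary theory of the
Frobenius automorphisms*, arXiv:math/0406514, Theorem 1.1 and Corollary 1.2 [Hrushovski2004]
(the "twisted Lang–Weil estimate"; Varshavsky gives a short geometric proof of its qualitative form;
uniform bounds: Shuddhodan–Varshavsky 2022 [ShuddhodanVarshavsky2022], not vendored).

PRINTED STATEMENT (Varshavsky, Thm. 1). `𝔽_q` finite, `𝔽` an algebraic closure, `X⁰` a scheme of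
finite type over `𝔽` defined over `𝔽_q`, `φ_q : X⁰ → X⁰` the geometric Frobenius over `𝔽_q`,
`Γ⁰_{qⁿ} ⊂ X⁰ × X⁰` the graph of `φ_{qⁿ} = φ_qⁿ`. Let `c⁰ = (c⁰₁, c⁰₂) : C⁰ → X⁰ × X⁰` be a morphism of
schemes of finite type over `𝔽` such that `X⁰` and `C⁰` are irreducible, both `c⁰₁` and `c⁰₂` are
dominant, and `X⁰` is defined over `𝔽_q`. Then for every sufficiently large `n` the preimage
`(c⁰)⁻¹(Γ⁰_{qⁿ})` is non-empty. Cor. 2: `⋃ₙ (c⁰)⁻¹(Γ⁰_{qⁿ})` is Zariski dense in `C⁰`. (Hrushovski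
Cor. 1.2: `X` affine over `GF(q)`, `S ⊂ X²` irreducible over `kᵃ` with both projections dominant ⇒
for any proper subvariety `W ⊂ X`, for large `m` there is `x ∈ X(kᵃ)` with `(x, φ_q^m(x)) ∈ S`,
`x ∉ W`.)

RENDERING (affine, coordinates; a special case of the printed theorem, chosen so that no scheme
theory is needed by its consumers): `𝔽 = F` is an algebraically closed field algebraic over
`ZMod p` (an algebraic closure of `𝔽_p`), `q = pᵃ`; "defined over `𝔽_q`" = all coefficients `c` of the
defining polynomials satisfy `c^q = c`; `X = V(S) ∩ D(g) ⊆ 𝔽ᴺ` with `S, g` over `𝔽_q` (an open piece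
of an affine `𝔽_q`-scheme, so `φ_{qⁿ}` acts on `X(𝔽)` by `x ↦ (xᵢ^{qⁿ})ᵢ`); `C = V(T) ∩ D(h) ⊆ X × X`
a locally closed subset of `𝔽ᴺ × 𝔽ᴺ = 𝔽^{N ⊕ N}` (any coefficients), `c⁰` the inclusion;
"irreducible" = the vanishing ideal (Mathlib `MvPolynomial.vanishingIdeal F`, points and coefficients in `F`) is prime (closed points
of a finite-type `𝔽`-scheme are dense, so this is irreducibility of the scheme; prime ideals are
proper, so `X, C ≠ ∅`); "`c⁰ᵢ` dominant" = every polynomial vanishing on `prᵢ(C)` vanishes on `X`,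
i.e. `vanishingIdeal (prᵢ '' C) = vanishingIdeal X`; "`(c⁰)⁻¹(Γ⁰_{qⁿ}) ≠ ∅`" = some `(x, y) ∈ C`
has `y = φ_{qⁿ}(x)` (a non-empty finite-type `𝔽`-scheme has an `𝔽`-point). The basic open pieces
`D(g)`, `D(h)` cost nothing (an open of an irreducible scheme is irreducible and still dominant) and
make Cor. 2 the special case `h ↦ h·h'` of Thm. 1 — it is nevertheless recorded separately.

Grounding note (grounder, route `ResolutionOfSingularities/FrobeniusClosing`): this is the
"closing lemma" input (ii) of the proof plan of
`Summit.ResolutionOfSingularities.ResolutionOfSingularities.Theses.FrobeniusClosing.ClosingReduction`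
and the cited engine of the support item `…FrobeniusClosing.ClosingLemma` (periodic paths of a
constructible correspondence over a finite field from infinite ones). Nothing of the kind was in
the tree (`lean search 'LangWeil|Hrushovski|Varshavsky'`: only the classical Lang–Weil statements
of `ModelTheory/PseudofiniteFields` and `CafureMatera.lean`).

## Not vendored

* The quantitative Thm. 1.1 of Hrushovski (`|S(k) ∩ Φ_q(k)| = a qᵈ + O(q^{d−1/2})`) and its uniform
  version (Shuddhodan–Varshavsky 2022, Thm. 2.x) — no consumer yet; Cor. 3 (Borisov–Sapir
  quasi-fixed points) and Cor. 4 (Fakhruddin: periodic points of a dominant self-map are dense)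
  follow from `thm1_affine`/`cor2_affine` with `C` the graph of the map.
-/

noncomputable section

open MvPolynomial

namespace Literature.NumberTheory.DiophantineGeometry

namespace Varshavsky2014

/-- The `𝔽`-points of the **affine locally closed set `V(S) ∩ D(g)`**: common zeros of the
polynomials in `S` at which `g` does not vanish (`g = 1`: the closed set `V(S)`).
[cite: Varshavsky2014, Introduction (notation `X⁰`)] -/
def locus {σ F : Type*} [CommSemiring F] (S : Set (MvPolynomial σ F)) (g : MvPolynomial σ F) :
    Set (σ → F) :=
  {x | (∀ f ∈ S, MvPolynomial.eval x f = 0) ∧ MvPolynomial.eval x g ≠ 0}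

/-- A polynomial is **defined over `𝔽_q`** (`q = pᵃ`, inside a field `F ⊇ 𝔽_p`): all its
coefficients lie in the subfield `𝔽_q = {c | c^q = c}` of `F`.
[cite: Varshavsky2014, Introduction ("`X⁰` defined over `𝔽_q`")] -/
def IsDefinedOver {σ F : Type*} [CommSemiring F] (q : ℕ) (f : MvPolynomial σ F) : Prop :=
  ∀ m, MvPolynomial.coeff m f ^ q = MvPolynomial.coeff m f

/-- The **geometric `qⁿ`-Frobenius on coordinates**: `x ↦ (xᵢ^{qⁿ})ᵢ` (on the `𝔽`-points of an
affine scheme defined over `𝔽_q` this is `φ_{qⁿ} = φ_qⁿ`). [cite: Varshavsky2014, Introduction] -/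
def frob {σ F : Type*} [CommSemiring F] (q n : ℕ) (x : σ → F) : σ → F :=
  fun i => x i ^ q ^ n

/-- **Varshavsky (2018), Theorem 1 = Hrushovski (2004), Corollary 1.2 — a correspondence with
dominant projections meets the graph of every sufficiently large power of Frobenius; affine form.**
Let `p` be prime, `F` an algebraic closure of `𝔽_p`, `q = pᵃ` (`a ≥ 1`), `N ∈ ℕ`. Let
`X = V(S) ∩ D(g) ⊆ Fᴺ` with `S` and `g` defined over `𝔽_q`, and let `C = V(T) ∩ D(h) ⊆ Fᴺ × Fᴺ`
(coefficients anywhere in `F`) with `C ⊆ X × X`. Assume `X` and `C` are irreducible (their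
vanishing ideals are prime) and both projections `C → X` are dominant (a polynomial vanishing on
`prᵢ(C)` vanishes on `X`). Then there is `n₀` such that for every `n ≥ n₀` some `(x, y) ∈ C` has
`y = φ_{qⁿ}(x) = (xᵢ^{qⁿ})ᵢ`. Named fact (special case of the printed Thm. 1 with `X⁰` the open
piece `D(g)` of the affine `𝔽_q`-scheme `Spec 𝔽_q[x]/(S) ⊗ F` and `c⁰` the inclusion of the reduced
locally closed subscheme supported on `C`), not proved here; grounds input (ii) of
`Summit.ResolutionOfSingularities.ResolutionOfSingularities.Theses.FrobeniusClosing.ClosingReduction`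
(via the support item `ClosingLemma`). [cite: Varshavsky2014, Thm. 1] [cite: Hrushovski2004, Cor. 1.2] -/
def thm1_affine : Prop :=
  ∀ (p : ℕ) [Fact p.Prime] (F : Type) [Field F] [Algebra (ZMod p) F] [IsAlgClosed F]
    [Algebra.IsAlgebraic (ZMod p) F] (a : ℕ), 0 < a →
    ∀ (N : ℕ) (S : Set (MvPolynomial (Fin N) F)) (g : MvPolynomial (Fin N) F)
      (T : Set (MvPolynomial (Fin N ⊕ Fin N) F)) (h : MvPolynomial (Fin N ⊕ Fin N) F),
      (∀ f ∈ S, IsDefinedOver (p ^ a) f) → IsDefinedOver (p ^ a) g →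
      (MvPolynomial.vanishingIdeal F (locus S g)).IsPrime →
      (MvPolynomial.vanishingIdeal F (locus T h)).IsPrime →
      (∀ w ∈ locus T h, (w ∘ Sum.inl) ∈ locus S g ∧ (w ∘ Sum.inr) ∈ locus S g) →
      MvPolynomial.vanishingIdeal F ((fun w => w ∘ Sum.inl) '' locus T h) =
        MvPolynomial.vanishingIdeal F (locus S g) →
      MvPolynomial.vanishingIdeal F ((fun w => w ∘ Sum.inr) '' locus T h) =
        MvPolynomial.vanishingIdeal F (locus S g) →
      ∃ n₀ : ℕ, ∀ n : ℕ, n₀ ≤ n →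
        ∃ w ∈ locus T h, w ∘ Sum.inr = frob (p ^ a) n (w ∘ Sum.inl)

/-- **Varshavsky (2018), Corollary 2 — the Frobenius-twisted points are Zariski dense; affine
form.** In the situation of `thm1_affine`, `⋃ₙ (c⁰)⁻¹(Γ⁰_{qⁿ})` is Zariski dense in `C`; rendered in
the form the printed proof gives verbatim (apply Thm. 1 to the open `C' = C ∖ Z`, for all large
`n`): for every `n₀` and every polynomial `h'` that does not vanish identically on `C` there are
`n ≥ n₀` and `(x, y) ∈ C` with `h'(x, y) ≠ 0` and `y = φ_{qⁿ}(x)` (the basic opens `C ∩ D(h')` form a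
base of the Zariski topology of `C`; `n₀` also keeps the trivial case `n = 0`, `Γ_1 = Δ`, out of the
statement). This is Hrushovski's Cor. 1.2 with `W = V(h')`-type exceptional sets. Named fact, not
proved here (it is `thm1_affine` applied to `h·h'` once irreducibility and dominance of `C ∩ D(h')`
are checked). [cite: Varshavsky2014, Cor. 2] [cite: Hrushovski2004, Cor. 1.2] -/
def cor2_affine : Prop :=
  ∀ (p : ℕ) [Fact p.Prime] (F : Type) [Field F] [Algebra (ZMod p) F] [IsAlgClosed F]
    [Algebra.IsAlgebraic (ZMod p) F] (a : ℕ), 0 < a →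
    ∀ (N : ℕ) (S : Set (MvPolynomial (Fin N) F)) (g : MvPolynomial (Fin N) F)
      (T : Set (MvPolynomial (Fin N ⊕ Fin N) F)) (h : MvPolynomial (Fin N ⊕ Fin N) F),
      (∀ f ∈ S, IsDefinedOver (p ^ a) f) → IsDefinedOver (p ^ a) g →
      (MvPolynomial.vanishingIdeal F (locus S g)).IsPrime →
      (MvPolynomial.vanishingIdeal F (locus T h)).IsPrime →
      (∀ w ∈ locus T h, (w ∘ Sum.inl) ∈ locus S g ∧ (w ∘ Sum.inr) ∈ locus S g) →
      MvPolynomial.vanishingIdeal F ((fun w => w ∘ Sum.inl) '' locus T h) =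
        MvPolynomial.vanishingIdeal F (locus S g) →
      MvPolynomial.vanishingIdeal F ((fun w => w ∘ Sum.inr) '' locus T h) =
        MvPolynomial.vanishingIdeal F (locus S g) →
      ∀ (n₀ : ℕ) (h' : MvPolynomial (Fin N ⊕ Fin N) F),
        (∃ w ∈ locus T h, MvPolynomial.eval w h' ≠ 0) →
        ∃ (n : ℕ) (w : Fin N ⊕ Fin N → F), n₀ ≤ n ∧ w ∈ locus T h ∧
          MvPolynomial.eval w h' ≠ 0 ∧ w ∘ Sum.inr = frob (p ^ a) n (w ∘ Sum.inl)

end Varshavsky2014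

end Literature.NumberTheory.DiophantineGeometry

end
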